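import Literature.NumberTheory.Automorphic.AutomorphicQuotientKernelConvolution
import HarnessLib

/-!
# The kernel of `R(f)` on a non-compact quotient: bounded sections, and the Hilbert–Schmidt
# identity `Σ_i ‖R(f) e_i‖² = c⁻² ∬ |K_f|²` in `[0, ∞]`
(Gelbart, *Automorphic forms on adele groups* (1975), (9.20), p. 120, Prop. 9.6, p. 122;
Bump (1997), Thm. 2.3.2 (3.3))

Topic `NumberTheory/Automorphic`; theorems only (no definition, no named fact, no instance
visible to importers). Continuation of `AutomorphicQuotientKernel` /
`AutomorphicQuotientKernelCompact`, dropping their compactness hypothesis. A brick of the inline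
(D-0026) decomposition of the named fact
`Literature.NumberTheory.Automorphic.jacquetLanglands_transfer_exists` (`JacquetLanglandsParts`,
Gelbart (1975), Thm. 10.5 (i)) on the `GL₂` side of the trace-formula comparison: for the
*non-compact* automorphic quotient of `GL₂` the kernel `K_f(x, y)` of `R(f)` (Gelbart (9.20)) is
continuous but unbounded, and `R(f)` is Hilbert–Schmidt only on the cuspidal subspace (Prop. 9.6:
"`R₀(h)φ(x) = (k_x, φ)` with `k_x ∈ L₀²(X)` … `k(x, y) = k_x(y)` … `k(x, y) ∈ L²(X × X)`. Thus
`R₀(h)` is Hilbert–Schmidt"). What survives without compactness, and is proved here: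

* `exists_norm_cosetKernel_le`, `exists_norm_quotientKernel_le_of_left` — **every section
  `y ↦ K_f(x, y)` of the kernel of `f ∈ C_c(G)` is bounded** (for a closed subgroup `H` of a
  topological group `G` and a left invariant measure `ρ` on `H` finite on compact sets): if
  `f(x̃ h⁻¹ ỹ⁻¹) ≠ 0` then `h` lies in a left translate of the compact
  `H ∩ x̃⁻¹ (supp f)(supp f)⁻¹ x̃`, whose `ρ`-measure bounds the integral uniformly in `ỹ`.
  (The bound depends on `x`; `K_f(x, x)` does grow in the cusp.) Hence
  `memLp_two_quotientKernel_section`: the sections are in `L²(X, μ)` for a finite measure `μ`.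
* `hasSum_norm_sq_integral_kernel_mul_of_memLp`, `tsum_lintegral_enorm_sq_integral_kernel_mul`,
  `tsum_enorm_sq_apply_eq_of_ae_eq_smul_integral` — **the Hilbert–Schmidt identity for an integral
  operator whose kernel has `L²` sections**, in `[0, ∞]` (abstract; finite measure space, countable
  Hilbert basis): `Σ'_i ∫⁻ |∫ K(x, y) e_i(y) dμ(y)|² dμ(x) = ∫⁻ ∫⁻ |K(x, y)|² dμ(y) dμ(x)` —
  Parseval in each fibre (`Literature.Analysis.OperatorTheory.hasSum_norm_sq_integral_kernel_mul`
  asks for a *bounded* kernel; only `K(x, ·) ∈ L²` is used) and monotone convergence; and for an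
  operator `T` with `T v = c • ∫ K(·, y) v(y) dμ(y)` a.e., `Σ'_i ‖T e_i‖ₑ² = ofReal (c²) · ∬ ‖K‖ₑ²`.
  No finiteness is asserted or needed on either side (Bump (1997), Thm. 2.3.2: "`Σ |f_i|² =
  ∬ K K̄ dx dy`", here as an identity of extended reals).
* `AdelicGroupData.tsum_enorm_sq_integratedOperator_rightRegular_eq` — for an adelic group datum
  with `G(𝔸_K)` locally compact, second countable and Hausdorff, `H = A_G · G(K)` closed and
  unimodular (`ρ ≠ 0` two-sided invariant, finite on compacts, s-finite), an automorphic measure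
  `μ`, an inversion-invariant Haar measure `ν` and `f ∈ C_c(G(𝔸_K))`: **for every countable Hilbert
  basis `(e_i)` of `L²(X, μ)`, `Σ'_i ‖R(f) e_i‖ₑ² = ofReal (c⁻²) · ∫⁻_X ∫⁻_X ‖K_f(x, y)‖ₑ² dμ dμ`**,
  `K_f = quotientKernel H ρ f`, `c = unfoldingConstant H ρ μ ν` — the compact-quotient identity
  `hasSum_norm_sq_integratedOperator_rightRegular` of `AutomorphicQuotientKernelCompact` without
  `CompactSpace`, both sides now possibly infinite. In particular `R(f)` is Hilbert–Schmidt on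
  `L²(X)` iff `K_f ∈ L²(X × X)` (`…_lt_top_iff`). For `GL_n` and an `f` whose `R(f)` factors
  through `L²_cusp` this is Gelbart's "`k(x, y) ∈ L²(X × X)`" (Prop. 9.6), the entry point of the
  cuspidal trace formula (10.15).

## References

* S. Gelbart, *Automorphic forms on adele groups*, Ann. of Math. Studies 83 (1975), (9.7), (9.20),
  Prop. 9.6 (p. 122), (10.13)–(10.15) [Gelbart1975].
* D. Bump, *Automorphic Forms and Representations* (1997), §2.3, Thm. 2.3.2 eq. (3.3) [Bump1997].
-/

noncomputable section

open MeasureTheory Measure Set Filter Topology CompactlySupported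
open Literature.MeasureTheory.Group
open scoped ENNReal NNReal Pointwise InnerProductSpace ComplexConjugate

namespace Literature.NumberTheory.Automorphic

-- the coset space carries the Borel σ-algebra supplied by the user, not the quotient σ-algebra
attribute [-instance] Quotient.instMeasurableSpace QuotientGroup.measurableSpace

/-! ### The Hilbert–Schmidt identity for kernels with `L²` sections (abstract) -/

section Abstract

variable {X : Type*} [MeasurableSpace X] {μ : Measure X} {𝕜 : Type*} [RCLike 𝕜]

/-- `‖f‖ₑ² = ∫⁻ ‖f(x)‖ₑ² dμ` for `f ∈ L²(μ)`. [folklore] -/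
theorem enorm_Lp_two_sq_eq_lintegral {E : Type*} [NormedAddCommGroup E] (f : Lp E 2 μ) :
    ‖f‖ₑ ^ 2 = ∫⁻ x, ‖f x‖ₑ ^ 2 ∂μ := by
  have h2 : (2 : ℝ≥0∞).toReal = 2 := by norm_num
  rw [Lp.enorm_def, eLpNorm_eq_eLpNorm' two_ne_zero ENNReal.ofNat_ne_top, h2,
    ← ENNReal.rpow_two, ← lintegral_rpow_enorm_eq_rpow_eLpNorm' zero_lt_two]
  simp_rw [ENNReal.rpow_two]

/-- The conjugate of an `ℒ²` function is in `ℒ²`. [folklore] -/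
theorem memLp_two_conj {k : X → 𝕜} (hk : MemLp k 2 μ) : MemLp (fun y => conj (k y)) 2 μ := by
  refine ⟨RCLike.continuous_conj.comp_aestronglyMeasurable hk.1, ?_⟩
  rw [eLpNorm_congr_norm_ae (Eventually.of_forall fun y => RCLike.norm_conj (k y))]
  exact hk.2

/-- **`(T_K φ)(x)` is an inner product** when the section `K(x, ·)` is in `ℒ²`:
`∫ K(x, y) φ(y) dμ(y) = ⟪\overline{K(x, ·)}, φ⟫_{L²}` (Bump (1997), proof of Thm. 2.3.2).
[cite: Bump1997, Ch. 2 §2.3 Thm. 2.3.2 (proof)] -/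
theorem integral_kernel_mul_eq_inner_of_memLp {K : X → X → 𝕜} {x : X}
    (hKx : MemLp (fun y => K x y) 2 μ) (φ : Lp 𝕜 2 μ) :
    ∫ y, K x y * φ y ∂μ = ⟪(memLp_two_conj hKx).toLp _, φ⟫_𝕜 := by
  rw [L2.inner_def]
  refine integral_congr_ae ?_
  filter_upwards [(memLp_two_conj (μ := μ) hKx).coeFn_toLp] with y hy
  rw [hy, RCLike.inner_apply, RCLike.conj_conj, mul_comm]

/-- **Pointwise Parseval for a kernel with `L²` section** (Bump (1997), proof of Thm. 2.3.2): for a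
countable Hilbert basis `(e_i)` of `L²(X, μ)` and a point `x` with `K(x, ·) ∈ ℒ²`,
`Σ_i |∫ K(x, y) e_i(y) dμ(y)|² = ∫ |K(x, y)|² dμ(y)`. The bounded-kernel version is
`Literature.Analysis.OperatorTheory.hasSum_norm_sq_integral_kernel_mul`.
[cite: Bump1997, Ch. 2 §2.3 Thm. 2.3.2 (proof)] -/
theorem hasSum_norm_sq_integral_kernel_mul_of_memLp {ι : Type*} {K : X → X → 𝕜} {x : X}
    (hKx : MemLp (fun y => K x y) 2 μ) (b : HilbertBasis ι 𝕜 (Lp 𝕜 2 μ)) :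
    HasSum (fun i => ‖∫ y, K x y * b i y ∂μ‖ ^ 2) (∫ y, ‖K x y‖ ^ 2 ∂μ) := by
  set k : Lp 𝕜 2 μ := (memLp_two_conj hKx).toLp _ with hk
  have h := (b.hasSum_inner_mul_inner k k).map RCLike.re RCLike.continuous_re
  have hnorm : ‖k‖ ^ 2 = ∫ y, ‖K x y‖ ^ 2 ∂μ := by
    rw [hk, Literature.Analysis.OperatorTheory.norm_toLp_sq_eq_integral_norm_sq]
    simp only [RCLike.norm_conj]
  rw [← hnorm, ← inner_self_eq_norm_sq (𝕜 := 𝕜)]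
  convert h using 1
  funext i
  simp only [Function.comp_apply]
  rw [← inner_conj_symm k (b i), RCLike.conj_mul, ← RCLike.ofReal_pow, RCLike.ofReal_re,
    ← inner_conj_symm (b i) k, RCLike.norm_conj, ← integral_kernel_mul_eq_inner_of_memLp hKx (b i)]

variable [IsFiniteMeasure μ]

/-- **The Hilbert–Schmidt identity in `[0, ∞]` for a kernel with `L²` sections.** Let `μ` be
finite, `K : X × X → 𝕜` jointly strongly measurable with every section `K(x, ·) ∈ ℒ²(μ)`, and
`(e_i)` a countable Hilbert basis of `L²(X, μ)`. Then
`Σ'_i ∫⁻ ‖∫ K(x, y) e_i(y) dμ(y)‖ₑ² dμ(x) = ∫⁻ ∫⁻ ‖K(x, y)‖ₑ² dμ(y) dμ(x)` — fibrewise Parseval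
(`hasSum_norm_sq_integral_kernel_mul_of_memLp`) summed by monotone convergence (Mathlib
`lintegral_tsum`); both sides may be `∞` (Bump (1997), Thm. 2.3.2 (3.3), there for bounded `K`).
[cite: Bump1997, Ch. 2 §2.3 Thm. 2.3.2 eq. (3.3)] -/
theorem tsum_lintegral_enorm_sq_integral_kernel_mul {ι : Type*} [Countable ι] {K : X → X → 𝕜}
    (hK : StronglyMeasurable (Function.uncurry K)) (hK2 : ∀ x, MemLp (fun y => K x y) 2 μ)
    (b : HilbertBasis ι 𝕜 (Lp 𝕜 2 μ)) :
    ∑' i, ∫⁻ x, ‖∫ y, K x y * b i y ∂μ‖ₑ ^ 2 ∂μ = ∫⁻ x, ∫⁻ y, ‖K x y‖ₑ ^ 2 ∂μ ∂μ := by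
  -- measurability of the summands
  have hmeas : ∀ i, AEMeasurable (fun x => ‖∫ y, K x y * b i y ∂μ‖ₑ ^ 2) μ := fun i =>
    ((Literature.Analysis.OperatorTheory.stronglyMeasurable_integral_kernel_mul hK
      (b i)).measurable.enorm.pow_const 2).aemeasurable
  rw [← lintegral_tsum hmeas]
  refine lintegral_congr fun x => ?_
  -- fibrewise Parseval, transported to `ℝ≥0∞`
  have hpars := hasSum_norm_sq_integral_kernel_mul_of_memLp (hK2 x) b
  have h0 : ∀ i, 0 ≤ ‖∫ y, K x y * b i y ∂μ‖ ^ 2 := fun i => sq_nonneg _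
  have h1 : ∑' i, ‖∫ y, K x y * b i y ∂μ‖ₑ ^ 2 =
      ∑' i, ENNReal.ofReal (‖∫ y, K x y * b i y ∂μ‖ ^ 2) := by
    refine tsum_congr fun i => ?_
    rw [ENNReal.ofReal_pow (norm_nonneg _), ofReal_norm]
  have hint : Integrable (fun y => ‖K x y‖ ^ 2) μ :=
    (memLp_two_iff_integrable_sq_norm (hK2 x).1).1 (hK2 x)
  rw [h1, ← ENNReal.ofReal_tsum_of_nonneg h0 hpars.summable, hpars.tsum_eq,
    ofReal_integral_eq_lintegral_ofReal hint (Eventually.of_forall fun y => sq_nonneg _)]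
  refine lintegral_congr fun y => ?_
  rw [ENNReal.ofReal_pow (norm_nonneg _), ofReal_norm]

/-- **Hilbert–Schmidt sum of an operator given a.e. by a kernel with `L²` sections.** If
`T : L²(μ) → L²(μ)` satisfies `T v = c • ∫ K(·, y) v(y) dμ(y)` a.e. for every `v` (real scalar
`c`), with `K` jointly strongly measurable and all sections in `ℒ²`, then for every countable
Hilbert basis `(e_i)`, `Σ'_i ‖T e_i‖ₑ² = ofReal (c²) · ∫⁻ ∫⁻ ‖K(x, y)‖ₑ² dμ(y) dμ(x)` in `[0, ∞]`
(Bump (1997), Thm. 2.3.2: the operator is Hilbert–Schmidt iff the kernel is square integrable).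
[cite: Bump1997, Ch. 2 §2.3 Thm. 2.3.2] -/
theorem tsum_enorm_sq_apply_eq_of_ae_eq_smul_integral {ι : Type*} [Countable ι] {K : X → X → 𝕜}
    (hK : StronglyMeasurable (Function.uncurry K)) (hK2 : ∀ x, MemLp (fun y => K x y) 2 μ)
    (T : Lp 𝕜 2 μ → Lp 𝕜 2 μ) (c : ℝ)
    (hT : ∀ v : Lp 𝕜 2 μ, (T v : X → 𝕜) =ᵐ[μ] fun x => c • ∫ y, K x y * v y ∂μ)
    (b : HilbertBasis ι 𝕜 (Lp 𝕜 2 μ)) :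
    ∑' i, ‖T (b i)‖ₑ ^ 2 = ENNReal.ofReal (c ^ 2) * ∫⁻ x, ∫⁻ y, ‖K x y‖ₑ ^ 2 ∂μ ∂μ := by
  have hmeas : ∀ i, AEMeasurable (fun x => ‖∫ y, K x y * b i y ∂μ‖ₑ ^ 2) μ := fun i =>
    ((Literature.Analysis.OperatorTheory.stronglyMeasurable_integral_kernel_mul hK
      (b i)).measurable.enorm.pow_const 2).aemeasurable
  have hterm : ∀ i, ‖T (b i)‖ₑ ^ 2 =
      ENNReal.ofReal (c ^ 2) * ∫⁻ x, ‖∫ y, K x y * b i y ∂μ‖ₑ ^ 2 ∂μ := by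
    intro i
    rw [enorm_Lp_two_sq_eq_lintegral, ← lintegral_const_mul'' _ (hmeas i)]
    refine lintegral_congr_ae ?_
    filter_upwards [hT (b i)] with x hx
    rw [hx, enorm_smul, mul_pow, Real.enorm_eq_ofReal_abs, ← ENNReal.ofReal_pow (abs_nonneg c),
      sq_abs]
  simp_rw [hterm]
  rw [ENNReal.tsum_mul_left, tsum_lintegral_enorm_sq_integral_kernel_mul hK hK2 b]

end Abstract

/-! ### Bounded sections of the kernel of `f ∈ C_c(G)` for a closed subgroup `H` -/

section Sections

variable {G : Type*} [Group G] [TopologicalSpace G] [IsTopologicalGroup G] [LocallyCompactSpace G]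
  [SecondCountableTopology G] [T2Space G] [MeasurableSpace G] [BorelSpace G]
  (H : Subgroup G) [hH : IsClosed (H : Set G)]
  (ρ : Measure H) [ρ.IsMulLeftInvariant] [SFinite ρ] [IsFiniteMeasureOnCompacts ρ]
  [MeasurableSpace (G ⧸ H)] [BorelSpace (G ⧸ H)]
  {𝕜 : Type*} [RCLike 𝕜]

/-- **Each section of the kernel is bounded.** For a closed subgroup `H`, a left invariant measure
`ρ` on `H` finite on compact sets, `f ∈ C_c(G)` and a fixed `x̃ ∈ G`, the function
`ỹH ↦ K_f(x̃, ỹH) = ∫_H f(x̃ h⁻¹ ỹ⁻¹) dρ(h)` (`cosetKernel`) is bounded on `G ⧸ H`: the integrand is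
supported on `{h : (h : G) ∈ ỹ⁻¹ S⁻¹ x̃}`, `S = supp f`, and any two points `h₀, h` of that set have
`h₀⁻¹ h ∈ x̃⁻¹ S S⁻¹ x̃`, so it lies in a left translate of the compact `B = H ∩ x̃⁻¹ S S⁻¹ x̃`, of
measure `ρ(B) < ∞`; hence `‖K_f(x̃, ỹH)‖ ≤ ‖f‖_∞ ρ(B)` for all `ỹ` (Gelbart (1975), p. 120: for
`x` in a compact set the sum `Σ_γ f(x⁻¹ γ y)` is finite — here uniformly in `y`).
[cite: Gelbart1975, (9.20)] -/
theorem exists_norm_cosetKernel_le {f : G → 𝕜} (hf : Continuous f) (hfs : HasCompactSupport f)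
    (x₀ : G) : ∃ C : ℝ, ∀ y : G ⧸ H, ‖cosetKernel H ρ f x₀ y‖ ≤ C := by
  haveI : IsClosed (H : Set G) := hH
  obtain ⟨M, hM⟩ := hf.bounded_above_of_compact_support hfs
  have hM0 : 0 ≤ M := (norm_nonneg _).trans (hM 1)
  set S : Set G := tsupport f with hS
  have hSc : IsCompact S := hfs
  -- the compact `B = H ∩ x₀⁻¹ S S⁻¹ x₀` in `H`
  set T : Set G := {x₀⁻¹} * (S * S⁻¹) * {x₀} with hT
  have hTc : IsCompact T := ((isCompact_singleton.mul (hSc.mul hSc.inv)).mul isCompact_singleton)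
  set B : Set H := ((↑) : H → G) ⁻¹' T with hB
  have hBc : IsCompact B := hH.isClosedEmbedding_subtypeVal.isCompact_preimage hTc
  have hBfin : ρ B < ∞ := hBc.measure_lt_top
  refine ⟨M * (ρ B).toReal, fun y => ?_⟩
  induction y using QuotientGroup.induction_on with
  | H y₀ =>
    rw [cosetKernel_mk]
    -- the support of the integrand inside `H`
    set A : Set H := {h : H | x₀ * (h : G)⁻¹ * y₀⁻¹ ∈ S} with hA
    have hAc : IsClosed A := by
      refine (isClosed_tsupport f).preimage ?_
      exact (continuous_const.mul continuous_subtype_val.inv).mul continuous_const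
    have hzero : ∀ h : H, h ∉ A → f (x₀ * (h : G)⁻¹ * y₀⁻¹) = 0 := fun h hh =>
      image_eq_zero_of_notMem_tsupport hh
    -- `A` lies in a left translate of `B`
    have hAB : ρ A ≤ ρ B := by
      by_cases hAe : A = ∅
      · rw [hAe, measure_empty]; exact bot_le
      obtain ⟨h₀, hh₀⟩ := Set.nonempty_iff_ne_empty.2 hAe
      have hsub : A ⊆ h₀ • B := by
        intro h hh
        refine ⟨h₀⁻¹ * h, ?_, by simp⟩
        change ((h₀⁻¹ * h : H) : G) ∈ T
        have e : ((h₀⁻¹ * h : H) : G) =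
            x₀⁻¹ * ((x₀ * (h₀ : G)⁻¹ * y₀⁻¹) * (x₀ * (h : G)⁻¹ * y₀⁻¹)⁻¹) * x₀ := by
          simp only [Subgroup.coe_mul, InvMemClass.coe_inv, mul_inv_rev, inv_inv]
          group
        rw [e, hT]
        exact Set.mul_mem_mul (Set.mul_mem_mul (Set.mem_singleton _)
          (Set.mul_mem_mul hh₀ (Set.inv_mem_inv.2 hh))) (Set.mem_singleton _)
      calc ρ A ≤ ρ (h₀ • B) := measure_mono hsub
        _ = ρ B := measure_smul ρ h₀ B
    have hAfin : ρ A < ∞ := hAB.trans_lt hBfin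
    -- the integral is over `A`, where the integrand is bounded by `M`
    rw [← setIntegral_eq_integral_of_forall_compl_eq_zero (s := A) (fun h hh => hzero h hh)]
    calc ‖∫ h in A, f (x₀ * (h : G)⁻¹ * y₀⁻¹) ∂ρ‖ ≤ M * (ρ A).toReal :=
          norm_setIntegral_le_of_norm_le_const hAfin fun h _ => hM _
      _ ≤ M * (ρ B).toReal :=
          mul_le_mul_of_nonneg_left (ENNReal.toReal_mono hBfin.ne hAB) hM0

variable [ρ.IsMulRightInvariant]

/-- **Each section `y ↦ K_f(x, y)` of the kernel on `(G ⧸ H) × (G ⧸ H)` is bounded** (unimodular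
`H`; `exists_norm_cosetKernel_le` descended to `quotientKernel`). [cite: Gelbart1975, (9.20)] -/
theorem exists_norm_quotientKernel_le_of_left {f : G → 𝕜} (hf : Continuous f)
    (hfs : HasCompactSupport f) (x : G ⧸ H) :
    ∃ C : ℝ, ∀ y : G ⧸ H, ‖quotientKernel H ρ f x y‖ ≤ C := by
  induction x using QuotientGroup.induction_on with
  | H x₀ =>
    simp only [quotientKernel_mk]
    exact exists_norm_cosetKernel_le H ρ hf hfs x₀

/-- **The sections of the kernel are in `L²`** for a finite measure on the (locally compact, second
countable, Hausdorff) quotient: `y ↦ K_f(x, y)` is continuous (`continuous_uncurry_quotientKernel`)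
and bounded (`exists_norm_quotientKernel_le_of_left`) — Gelbart's "`k_x ∈ L₀²(X)`" (1975, proof of
Prop. 9.6, p. 122) for the untruncated kernel. [cite: Gelbart1975, Prop. 9.6 (proof, p. 122)] -/
theorem memLp_two_quotientKernel_section (μ : Measure (G ⧸ H)) [IsFiniteMeasure μ]
    {f : G → 𝕜} (hf : Continuous f) (hfs : HasCompactSupport f) (x : G ⧸ H) :
    MemLp (fun y => quotientKernel H ρ f x y) 2 μ := by
  obtain ⟨C, hC⟩ := exists_norm_quotientKernel_le_of_left H ρ hf hfs x
  have hc : Continuous fun y => quotientKernel H ρ f x y :=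
    (continuous_uncurry_quotientKernel H ρ hf hfs).comp (Continuous.prodMk_right x)
  exact MemLp.of_bound hc.aestronglyMeasurable C (Eventually.of_forall hC)

end Sections

/-! ### The Hilbert–Schmidt identity for `R(f)` on a non-compact automorphic quotient -/

namespace AdelicGroupData

universe u

variable {K : Type} [Field K] [NumberField K] (𝒢 : AdelicGroupData.{u} K)

attribute [local instance] measurableSpaceQuotientForm borelSpaceQuotientForm
  smulInvariantMeasureQuotientForm isFiniteMeasureOnCompactsQuotientForm

variable (μ : Measure 𝒢.automorphicQuotient) [𝒢.IsAutomorphicMeasure μ]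

attribute [local instance] isFiniteMeasureQuotientForm

variable [LocallyCompactSpace 𝒢.Adelic] [SecondCountableTopology 𝒢.Adelic] [T2Space 𝒢.Adelic]
  [MeasurableSpace 𝒢.Adelic] [BorelSpace 𝒢.Adelic]
  [hH : IsClosed (𝒢.quotientSubgroup : Set 𝒢.Adelic)]
  (ρ : Measure 𝒢.quotientSubgroup) [ρ.IsMulLeftInvariant] [ρ.IsMulRightInvariant]
  [IsFiniteMeasureOnCompacts ρ] [SFinite ρ]
  (ν : Measure 𝒢.Adelic) [IsHaarMeasure ν] [ν.IsInvInvariant]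

/-- **The sections of the kernel `K_f` of `R(f)` on an automorphic quotient are in `L²(X, μ)`**
(no compactness): `memLp_two_quotientKernel_section` for `H = A_G · G(K)` and the finite
automorphic measure `μ`. [cite: Gelbart1975, Prop. 9.6 (proof, p. 122)] -/
theorem memLp_two_quotientKernel_section' (f : C_c(𝒢.Adelic, ℂ)) (x : 𝒢.automorphicQuotient) :
    MemLp (fun y : 𝒢.automorphicQuotient => quotientKernel 𝒢.quotientSubgroup ρ f x y) 2 μ :=
  memLp_two_quotientKernel_section 𝒢.quotientSubgroup ρ (μ := μ) (f := (f : 𝒢.Adelic → ℂ))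
    f.continuous f.hasCompactSupport x

/-- **The Hilbert–Schmidt identity for `R(f)` on a (possibly non-compact) automorphic quotient**
(Gelbart (1975), (9.20) and Prop. 9.6; Bump (1997), Thm. 2.3.2). For an adelic group datum with
`G(𝔸_K)` locally compact, second countable and Hausdorff, `H = A_G · G(K)` closed and unimodular
(`ρ ≠ 0` a two-sided invariant s-finite measure on it, finite on compact sets), an automorphic
measure `μ`, an inversion-invariant Haar measure `ν` and `f ∈ C_c(G(𝔸_K))`: for every countable
Hilbert basis `(e_i)` of `L²(X, μ)`,
`Σ'_i ‖R(f) e_i‖ₑ² = ofReal (c⁻²) · ∫⁻_X ∫⁻_X ‖K_f(x, y)‖ₑ² dμ(y) dμ(x)` in `[0, ∞]`,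
`K_f = quotientKernel H ρ f`, `c = unfoldingConstant H ρ μ ν`: `R(f) v` is a.e.
`c⁻¹ ∫ K_f(·, y) v(y) dμ(y)` (`coeFn_integratedOperator_rightRegular_ae_eq_integral_quotientKernel`),
the kernel is jointly measurable with `L²` sections, and
`tsum_enorm_sq_apply_eq_of_ae_eq_smul_integral` applies. On a compact quotient both sides are
finite (`hasSum_norm_sq_integratedOperator_rightRegular`); in general `R(f)` is Hilbert–Schmidt on
`L²(X)` iff `K_f ∈ L²(X × X)`. [cite: Gelbart1975, (9.20) and Prop. 9.6 (p. 122)] -/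
theorem tsum_enorm_sq_integratedOperator_rightRegular_eq (hρ : ρ ≠ 0) (f : C_c(𝒢.Adelic, ℂ))
    {ι : Type*} [Countable ι] (b : HilbertBasis ι ℂ (𝒢.L2 μ)) :
    ∑' i, ‖(𝒢.rightRegular μ).integratedOperator (𝒢.isUnitary_rightRegular μ)
        (𝒢.isStronglyContinuous_rightRegular_holds μ) ν f (b i)‖ₑ ^ 2 =
      ENNReal.ofReal (((unfoldingConstant 𝒢.quotientSubgroup ρ μ ν : ℝ)⁻¹) ^ 2) *
        ∫⁻ x, ∫⁻ y, ‖quotientKernel 𝒢.quotientSubgroup ρ f x y‖ₑ ^ 2 ∂μ ∂μ :=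
  tsum_enorm_sq_apply_eq_of_ae_eq_smul_integral
    (stronglyMeasurable_uncurry_quotientKernel 𝒢 ρ f) (memLp_two_quotientKernel_section' 𝒢 μ ρ f)
    _ _ (coeFn_integratedOperator_rightRegular_ae_eq_integral_quotientKernel 𝒢 μ ρ ν hρ f) b

/-- **`R(f)` is Hilbert–Schmidt on `L²(X)` iff its kernel is square integrable on `X × X`**
(`tsum_enorm_sq_integratedOperator_rightRegular_eq` with `0 < c < ∞`; Bump (1997), Thm. 2.3.2;
Gelbart (1975), Prop. 9.6). [cite: Gelbart1975, Prop. 9.6 (p. 122)] -/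
theorem tsum_enorm_sq_integratedOperator_rightRegular_lt_top_iff (hρ : ρ ≠ 0)
    (f : C_c(𝒢.Adelic, ℂ)) {ι : Type*} [Countable ι] (b : HilbertBasis ι ℂ (𝒢.L2 μ)) :
    ∑' i, ‖(𝒢.rightRegular μ).integratedOperator (𝒢.isUnitary_rightRegular μ)
        (𝒢.isStronglyContinuous_rightRegular_holds μ) ν f (b i)‖ₑ ^ 2 < ∞ ↔
      ∫⁻ x, ∫⁻ y, ‖quotientKernel 𝒢.quotientSubgroup ρ f x y‖ₑ ^ 2 ∂μ ∂μ < ∞ := by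
  rw [tsum_enorm_sq_integratedOperator_rightRegular_eq 𝒢 μ ρ ν hρ f b]
  have hc : 0 < ((unfoldingConstant 𝒢.quotientSubgroup ρ μ ν : ℝ)⁻¹) ^ 2 := by
    have hpos : (0 : ℝ) < (unfoldingConstant 𝒢.quotientSubgroup ρ μ ν : ℝ) :=
      NNReal.coe_pos.2 (unfoldingConstant_pos 𝒢.quotientSubgroup ρ μ ν
        (IsAutomorphicMeasure.ne_zero 𝒢 μ) hρ)
    positivity
  have hc0 : ENNReal.ofReal (((unfoldingConstant 𝒢.quotientSubgroup ρ μ ν : ℝ)⁻¹) ^ 2) ≠ 0 :=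
    (ENNReal.ofReal_pos.2 hc).ne'
  constructor
  · intro h
    exact lt_top_iff_ne_top.2 fun htop => by
      rw [htop, ENNReal.mul_top hc0] at h
      exact lt_irrefl _ h
  · intro h
    exact ENNReal.mul_lt_top ENNReal.ofReal_lt_top h

end AdelicGroupData

end Literature.NumberTheory.Automorphic
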